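import Summits.HodgeConjecture.CorCM.GaloisDicyclicNondegenerate
import Summits.HodgeConjecture.CorCM.GaloisDodecicBinders
import HarnessLib

/-!
# Abelian varieties with an action of a Galois CM field of DICYCLIC Galois type `Dic_n` (`n = 2^k q` or `2^k`):
# `End⁰`-action binders and the class-target displays

COR-CM (cell `pub-hodgecm2`), binder seat b04 (gen 20), count-neutral claim DICYCLIC-TWO-SHEET, part VI — the
consumers of part IV (`CorCM/GaloisDicyclicNondegenerate`) in the `End⁰`-action format of gen 14's
`CorCM/GaloisDodecicBinders` and gen 19's `CorCM/GaloisImaginaryQuadraticBinders`.  KERNEL ONLY: theorems; no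
definition, no named fact, no `sorry`.  `HC_CM` is neither used nor claimed.

For a Galois CM field `F` with `Gal(F/ℚ) ≅ Dic_n` (Mathlib `QuaternionGroup n`, order `4n`):
* §1 `n = 2^k q`, `q` an odd prime: a SIMPLE complex abelian variety `X` of dimension `2n` with `φ : F →+* End⁰(X)`
  is isogenous to a realisation of a NONDEGENERATE CM type (Shimura's principal pair + part IV); hence `B = D` and
  **the Hodge conjecture for every abelian variety isogenous to a power `X^{N+1}`**, unconditionally.
* §2 `n = 2^k` (generalised quaternion `Q_{2^{k+2}}`): the same for EVERY abelian variety `X` of dimension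
  `2n = 2^{k+1}` with `φ : F →+* End⁰(X)` — no simplicity hypothesis (every CM type of `F` is nondegenerate, part IV),
  and such an `X` is automatically SIMPLE (`isSimple_of_ringHom_quaternion`).
* §3 `HCOnClass` displays for the two class targets.

## References

* [Shimura1998] G. Shimura, *Abelian Varieties with Complex Multiplication and Modular Functions*, §5.2, §7.1 Prop. 7,
  §8.2 Prop. 26.
* [Gordon1999HodgeAVSurvey] B. B. Gordon, *A survey of the Hodge conjecture for abelian varieties*, Thm. 6.3–6.4, §9.4.
* [vanGeemen1994HodgeAV] B. van Geemen, *An introduction to the Hodge conjecture for abelian varieties*, Lemma 3.7.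
-/

noncomputable section

open CategoryTheory CategoryTheory.Limits NumberField

namespace Summit.HodgeConjecture.CorCM.GaloisDicyclic

open Literature.NumberTheory.ComplexMultiplication
open Literature.AlgebraicGeometry Literature.AlgebraicGeometry.Motives Literature.AlgebraicGeometry.HodgeTheory
open Literature.AlgebraicGeometry.Motives.AbelianVariety
open Literature.AlgebraicGeometry.ComplexMultiplication
open Literature.AlgebraicGeometry.Pohlmann1968
open Summit.HodgeConjecture.HodgeConjecture.Ring2.ClassTargets

section Binders

variable {F : Type} [Field F] [NumberField F] [IsCMField F] [IsGalois ℚ F]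
variable {n : ℕ} [NeZero n]

/-! ### §1 `Dic_n`, `n = 2^k q`: simple abelian varieties of dimension `2n` with an `F`-action -/

/-- **Principal model with a nondegenerate type.**  `Gal(F/ℚ) ≅ Dic_n`, `n = 2^k q` (`q` an odd prime); `X` SIMPLE of
dimension `2n` with `φ : F →+* End⁰(X)` ⟹ some `X′` isogenous to `X` realises a NONDEGENERATE CM type of `F`.
[cite: Shimura1998, §7.1 Prop. 7 and §5.2] [cite: Gordon1999HodgeAVSurvey, §9.4] -/
theorem exists_isIsogenous_realisation_isNondegenerate_dicyclic {k q : ℕ} (hn : n = 2 ^ k * q) (hq : q.Prime)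
    (hq2 : q ≠ 2) (e : (F ≃ₐ[ℚ] F) ≃* QuaternionGroup n) {X : AbelianVariety ℂ} (hXs : X.IsSimple)
    (hXd : X.dim = 2 * n) (φ : F →+* X.endAlgebra) :
    ∃ (X' : AbelianVariety ℂ) (Φ : CMType F) (ι : 𝓞 F →+* End X')
      (θ : F →+* Module.End ℂ (complexBetti X'.X 1)),
      IsIsogenous X X' ∧ IsCMTypeRealisation Φ X' ι θ ∧ IsNondegenerate Φ := by
  obtain ⟨X', φ', ι', hφι, f, hf⟩ := exists_principal_pair φ
  have hdim' : Module.finrank ℚ F = 2 * X'.dim := by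
    rw [finrank_eq_four_mul e, ← dim_eq_of_isIsogeny hf, hXd]; ring
  have hreal := isCMTypeRealisation_cmTypeOfPair φ' hdim' ι' hφι
  obtain ⟨s₀⟩ := (inferInstance : Nonempty (F →+* ℂ))
  exact ⟨X', _, ι', _, ⟨f, hf⟩, hreal, isNondegenerate_of_isPrimitive_dicyclic hn hq hq2 e s₀
    ((isSimple_iff_isPrimitive hreal s₀).1 (hXs.of_isIsogeny hf))⟩

/-- **`B = D` for every complex abelian variety isogenous to a power `X^{N+1}`** of such an `X`.
[cite: Gordon1999HodgeAVSurvey, Thm. 6.4 and §9.4] [cite: vanGeemen1994HodgeAV, Lemma 3.7] -/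
theorem isDivisorGenerated_of_isIsogenous_powSucc_of_ringHom_dicyclic {k q : ℕ} (hn : n = 2 ^ k * q)
    (hq : q.Prime) (hq2 : q ≠ 2) (e : (F ≃ₐ[ℚ] F) ≃* QuaternionGroup n) {X : AbelianVariety ℂ} (hXs : X.IsSimple)
    (hXd : X.dim = 2 * n) (φ : F →+* X.endAlgebra) {B : AbelianVariety ℂ} {N : ℕ}
    (h : IsIsogenous B (X.powSucc N)) : IsDivisorGenerated B := by
  obtain ⟨X', Φ, ι, θ, hXX', hreal, hΦ⟩ :=
    exists_isIsogenous_realisation_isNondegenerate_dicyclic hn hq hq2 e hXs hXd φ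
  exact hΦ.isDivisorGenerated_of_isIsogenous_powSucc hreal (h.trans (isIsogenous_powSucc hXX' N))

/-- **The Hodge conjecture for every complex abelian variety isogenous to a power `X^{N+1}` of a SIMPLE abelian
variety `X` of dimension `2n` carrying an action `φ : F →+* End⁰(X)` of a Galois CM field `F` with
`Gal(F/ℚ) ≅ Dic_n`, `n = 2^k q` (`q` an odd prime)** — UNCONDITIONALLY. [cite: Gordon1999HodgeAVSurvey, Thm. 6.3–6.4 and §9.4]
[cite: vanGeemen1994HodgeAV, Lemma 3.7] -/
theorem hodgeConjectureFor_of_isIsogenous_powSucc_of_ringHom_dicyclic {k q : ℕ} (hn : n = 2 ^ k * q)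
    (hq : q.Prime) (hq2 : q ≠ 2) (e : (F ≃ₐ[ℚ] F) ≃* QuaternionGroup n) {X : AbelianVariety ℂ} (hXs : X.IsSimple)
    (hXd : X.dim = 2 * n) (φ : F →+* X.endAlgebra) {B : AbelianVariety ℂ} {N : ℕ}
    (h : IsIsogenous B (X.powSucc N)) : HodgeConjectureFor B.dim B.X :=
  hodgeConjectureFor_of_isDivisorGenerated _
    (isDivisorGenerated_of_isIsogenous_powSucc_of_ringHom_dicyclic hn hq hq2 e hXs hXd φ h)

/-- The variety itself (`N = 0`). [cite: Gordon1999HodgeAVSurvey, Thm. 6.3–6.4] -/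
theorem hodgeConjectureFor_of_ringHom_dicyclic {k q : ℕ} (hn : n = 2 ^ k * q) (hq : q.Prime) (hq2 : q ≠ 2)
    (e : (F ≃ₐ[ℚ] F) ≃* QuaternionGroup n) {X : AbelianVariety ℂ} (hXs : X.IsSimple) (hXd : X.dim = 2 * n)
    (φ : F →+* X.endAlgebra) : HodgeConjectureFor X.dim X.X :=
  hodgeConjectureFor_of_isIsogenous_powSucc_of_ringHom_dicyclic hn hq hq2 e hXs hXd φ (N := 0) (IsIsogenous.refl X)

/-! ### §2 Generalised quaternion `Q_{2^{k+2}} = Dic_{2^k}`: no simplicity hypothesis -/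

/-- **Principal model, `n = 2^k`**: ANY `X` of dimension `2n` with `φ : F →+* End⁰(X)` is isogenous to a realisation of
a (necessarily nondegenerate) CM type of `F`. [cite: Shimura1998, §7.1 Prop. 7 and §5.2] -/
theorem exists_isIsogenous_realisation_isNondegenerate_quaternion {k : ℕ} (hn : n = 2 ^ k)
    (e : (F ≃ₐ[ℚ] F) ≃* QuaternionGroup n) {X : AbelianVariety ℂ} (hXd : X.dim = 2 * n) (φ : F →+* X.endAlgebra) :
    ∃ (X' : AbelianVariety ℂ) (Φ : CMType F) (ι : 𝓞 F →+* End X')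
      (θ : F →+* Module.End ℂ (complexBetti X'.X 1)),
      IsIsogenous X X' ∧ IsCMTypeRealisation Φ X' ι θ ∧ IsNondegenerate Φ := by
  obtain ⟨X', φ', ι', hφι, f, hf⟩ := exists_principal_pair φ
  have hdim' : Module.finrank ℚ F = 2 * X'.dim := by
    rw [finrank_eq_four_mul e, ← dim_eq_of_isIsogeny hf, hXd]; ring
  have hreal := isCMTypeRealisation_cmTypeOfPair φ' hdim' ι' hφι
  exact ⟨X', _, ι', _, ⟨f, hf⟩, hreal, isNondegenerate_quaternion hn e _⟩

/-- **Such an `X` is SIMPLE** (it is isogenous to a realisation of a primitive type). [cite: Shimura1998, §8.2 Prop. 26] -/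
theorem isSimple_of_ringHom_quaternion {k : ℕ} (hn : n = 2 ^ k) (e : (F ≃ₐ[ℚ] F) ≃* QuaternionGroup n)
    {X : AbelianVariety ℂ} (hXd : X.dim = 2 * n) (φ : F →+* X.endAlgebra) : X.IsSimple := by
  obtain ⟨X', φ', ι', hφι, f, hf⟩ := exists_principal_pair φ
  have hdim' : Module.finrank ℚ F = 2 * X'.dim := by
    rw [finrank_eq_four_mul e, ← dim_eq_of_isIsogeny hf, hXd]; ring
  have hreal := isCMTypeRealisation_cmTypeOfPair φ' hdim' ι' hφι
  exact (isSimple_quaternion hn e hreal).of_isIsogeny_target hf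

/-- **`B = D` for everything isogenous to a power of `X`**, `n = 2^k`. [cite: Gordon1999HodgeAVSurvey, Thm. 6.4]
[cite: vanGeemen1994HodgeAV, Lemma 3.7] -/
theorem isDivisorGenerated_of_isIsogenous_powSucc_of_ringHom_quaternion {k : ℕ} (hn : n = 2 ^ k)
    (e : (F ≃ₐ[ℚ] F) ≃* QuaternionGroup n) {X : AbelianVariety ℂ} (hXd : X.dim = 2 * n) (φ : F →+* X.endAlgebra)
    {B : AbelianVariety ℂ} {N : ℕ} (h : IsIsogenous B (X.powSucc N)) : IsDivisorGenerated B := by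
  obtain ⟨X', Φ, ι, θ, hXX', hreal, hΦ⟩ := exists_isIsogenous_realisation_isNondegenerate_quaternion hn e hXd φ
  exact hΦ.isDivisorGenerated_of_isIsogenous_powSucc hreal (h.trans (isIsogenous_powSucc hXX' N))

/-- **The Hodge conjecture for every complex abelian variety isogenous to a power of an abelian variety `X` of
dimension `2^{k+1}` with an action of a Galois CM field with generalised quaternion Galois group `Q_{2^{k+2}}`**
(`Q₈`: fourfolds; `Q₁₆`: eightfolds; `Q₃₂`: sixteenfolds; …) — UNCONDITIONALLY, no simplicity hypothesis.
[cite: Gordon1999HodgeAVSurvey, Thm. 6.3–6.4] [cite: vanGeemen1994HodgeAV, Lemma 3.7] -/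
theorem hodgeConjectureFor_of_isIsogenous_powSucc_of_ringHom_quaternion {k : ℕ} (hn : n = 2 ^ k)
    (e : (F ≃ₐ[ℚ] F) ≃* QuaternionGroup n) {X : AbelianVariety ℂ} (hXd : X.dim = 2 * n) (φ : F →+* X.endAlgebra)
    {B : AbelianVariety ℂ} {N : ℕ} (h : IsIsogenous B (X.powSucc N)) : HodgeConjectureFor B.dim B.X :=
  hodgeConjectureFor_of_isDivisorGenerated _
    (isDivisorGenerated_of_isIsogenous_powSucc_of_ringHom_quaternion hn e hXd φ h)

/-- The variety itself. [cite: Gordon1999HodgeAVSurvey, Thm. 6.3–6.4] -/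
theorem hodgeConjectureFor_of_ringHom_quaternion {k : ℕ} (hn : n = 2 ^ k) (e : (F ≃ₐ[ℚ] F) ≃* QuaternionGroup n)
    {X : AbelianVariety ℂ} (hXd : X.dim = 2 * n) (φ : F →+* X.endAlgebra) : HodgeConjectureFor X.dim X.X :=
  hodgeConjectureFor_of_isIsogenous_powSucc_of_ringHom_quaternion hn e hXd φ (N := 0) (IsIsogenous.refl X)

end Binders

/-! ### §3 Class-target displays (`HCOnClass`) -/

/-- **HC on the class «isogenous to a power of a SIMPLE abelian variety `X` of dimension `2n` with an action of a
Galois CM field `F` with `Gal(F/ℚ) ≅ Dic_n`, `n = 2^k q`, `q` an odd prime»** (dimensions `2n(N+1)`), UNCONDITIONAL.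
[cite: Gordon1999HodgeAVSurvey, Thm. 6.3–6.4 and §9.4] -/
theorem hcOnClass_isIsogenous_powSucc_simple_galoisCM_dicyclic :
    HCOnClass fun B ↦ ∃ (X : AbelianVariety ℂ) (N : ℕ) (F : Type) (_ : Field F) (_ : NumberField F)
      (_ : IsCMField F) (_ : IsGalois ℚ F) (n k q : ℕ) (_ : NeZero n) (_ : (F ≃ₐ[ℚ] F) ≃* QuaternionGroup n),
      n = 2 ^ k * q ∧ q.Prime ∧ q ≠ 2 ∧ X.IsSimple ∧ X.dim = 2 * n ∧ Nonempty (F →+* X.endAlgebra) ∧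
      IsIsogenous B (X.powSucc N) := by
  rintro B ⟨X, N, F, _, _, _, _, n, k, q, _, e, hn, hq, hq2, hXs, hXd, ⟨φ⟩, h⟩
  exact hodgeConjectureFor_of_isIsogenous_powSucc_of_ringHom_dicyclic hn hq hq2 e hXs hXd φ h

/-- **HC on the class «isogenous to a power of an abelian variety `X` of dimension `2^{k+1}` with an action of a
Galois CM field `F` with `Gal(F/ℚ) ≅ Q_{2^{k+2}}`»**, UNCONDITIONAL — no simplicity hypothesis.
[cite: Gordon1999HodgeAVSurvey, Thm. 6.3–6.4 and §9.4] -/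
theorem hcOnClass_isIsogenous_powSucc_galoisCM_quaternion :
    HCOnClass fun B ↦ ∃ (X : AbelianVariety ℂ) (N : ℕ) (F : Type) (_ : Field F) (_ : NumberField F)
      (_ : IsCMField F) (_ : IsGalois ℚ F) (n k : ℕ) (_ : NeZero n) (_ : (F ≃ₐ[ℚ] F) ≃* QuaternionGroup n),
      n = 2 ^ k ∧ X.dim = 2 * n ∧ Nonempty (F →+* X.endAlgebra) ∧ IsIsogenous B (X.powSucc N) := by
  rintro B ⟨X, N, F, _, _, _, _, n, k, _, e, hn, hXd, ⟨φ⟩, h⟩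
  exact hodgeConjectureFor_of_isIsogenous_powSucc_of_ringHom_quaternion hn e hXd φ h

end Summit.HodgeConjecture.CorCM.GaloisDicyclic

end
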